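import Literature.NumberTheory.PAdicHodge.AinfWeierstrassDivisionLift
import Literature.NumberTheory.PAdicHodge.AinfWeierstrassOmegaPeriodAdd
import Literature.NumberTheory.PAdicHodge.BdRPlusEmbedding
import HarnessLib

/-!
# The ω-integrating element `b_ω ∈ B_dR⁺(F)` of the Kummer cocycle of a RATIONAL point of `Ŵ`, without a
# `(p, ξ)`-adic evaluation layer: `(σ − 1) b_ω = ∫_{κ_u(σ)} ω`

Topic `Literature/NumberTheory/PAdicHodge`; namespace `Literature.NumberTheory.PAdicHodge.AinfTop`. Sequel of
`AinfWeierstrassDivisionLift` (Fontaine's integral `[ũ] ∈ Ŵ(𝔫)` of a `[p]`-DIVISION sequence `u` of points of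
`Ŵ(𝔪_{ℂ_F})` and the identity `(σ − 1)[ũ] = [κ_u(σ)]`) and of `AinfWeierstrassOmegaPeriodAdd` (`ξ`-adic evaluation of
`log_W` on `Fil¹B_dR⁺`, additivity). This is floor 3 (ω-part) of brick K1 «Kummer classes die in `H¹(F, B_dR⁺ ⊗ V_pW)`»
of the hT₂ programme of crux K★ `stmt-BirchSwinnertonDyer-22226` (`Cruxes/StarredOptimalManinUnitFiveSeven/Lines/
kato-lever-hT2-programme.md` §4 K1) and the first half of Kato II Lemma 1.4.3 / Bloch–Kato Example 3.10.1.

THE POINT. Fontaine's own integrating element is `log_W(ι[ũ])`, which does NOT converge `ξ`-adically (`θ[ũ] = u₀ ≠ 0`,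
`ι[ũ] ∉ Fil¹`). When the base point `P = u₀` is RATIONAL — precisely: admits a `Γ_F`-FIXED lift `Q ∈ Ŵ(𝔫)`, `θ(Q) = P`,
`σQ = Q` (e.g. `P` with coordinate in `pℤ_p ⊂ 𝔸_inf`, §4) — the corrected element

  `z_u := [ũ] ⊖_W Q ∈ Ŵ(ker θ)`,   `b_ω := log_W(ι z_u) ∈ Fil¹ B_dR⁺`   (the EXISTING `ξ`-adic evaluation on `Fil¹`)

does the job: `σ z_u = z_u ⊕ [κ_u(σ)]` (`Q` is fixed, `(σ−1)[ũ] = [κ_u σ]`), hence by additivity of `log_W` on `Ŵ(Fil¹)`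

  **`σ(b_ω) − b_ω = log_W(ι[κ_u σ]) = ∫_{κ_u(σ)} ω`**   (`gal_bOmega_sub_bOmega`).

`b_ω` differs from Fontaine's element by the `Γ_F`-invariant constant `log_ω(P) ∈ F` (irrelevant for the coboundary;
it re-enters only in the explicit reciprocity law, Kato II Lemma 1.4.3–1.4.5).

* §1 points of `Ŵ(𝔫)` killed by `θ`, read in `Fil¹B_dR⁺` (`kerFil`; `Γ_F`, addition through the `ξ`-adic chord–tangent law);
* §2 **`log_W` on `Ŵ(ker θ)`** (`logKer`), its additivity (`logKer_add`, from `log_W(F_W(x,y)) = log_W x + log_W y` on `Fil¹`,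
  `log_evalPt_formalGroupLaw`), `Γ_F`-equivariance, the homomorphism `logKerHom : ker θ|_{Ŵ(𝔫)} →+ B_dR⁺`, and
  `logKer [τ] = ∫_τ ω` for `τ ∈ T_pŴ` (`logKer_torsionLiftHom`);
* §3 **the Kummer integral** `kummerIntegralPt u Q = [ũ] − Q`, `θ = 0`, `σ(z_u) = z_u + [κ_u σ]`, `bOmega`, and the
  coboundary identities `gal_bOmega_sub_bOmega` (sequence form) / `gal_bOmega_sub_bOmega_eq_omegaPeriodHom` (Tate-module form:
  `= omegaPeriodHom (kummerCocycle u σ)`), packaged as `exists_gal_sub_eq_omegaPeriodHom_kummerCocycle`; the rationality of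
  `u₀` (`σ u₀ = u₀`) is a CONSEQUENCE of the fixed lift (`galCBall_base_eq_of_fixedLift`);
* §4 the supply of fixed lifts for `ℚ_p`-rational base points: `zpPt c = (p·c viewed in 𝔸_inf) ∈ Ŵ(𝔫)` for `c ∈ ℤ_p`
  (`galPtN_zpPt`), and the corollary `exists_gal_sub_eq_omegaPeriod_of_zp`.

The η-part (`b_η := η₀(ι z_u) + ι C₀(Q, z_u) − ι·etaCorr(u)`, with the 2-cocycle identity of `C₀`) and the `Fil⁰`
bookkeeping in `B_dR⁺ ⊗ V` are the sequels. Definitions (reviewed): `kerFil`, `logKer`, `thetaKer`, `logKerHom`,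
`kummerIntegralPt`, `bOmega`, `zpPt`. No named facts, no `sorry`. BSD / K★ are not proved by any of this.

## References
* J.-M. Fontaine, *Le corps des périodes p-adiques*, Astérisque 223 (1994), Exp. II §1.2.2, §1.5.4. [FontaineAsterisque223III]
* S. Bloch, K. Kato, *L-functions and Tamagawa numbers of motives* (1990), Ex. 3.10.1, (3.11.1). [BlochKato1990]
* K. Kato, LNM 1553 (1993), Ch. II Lemma 1.4.3. [Kato1993LNM1553]
* J.-M. Fontaine, *Formes différentielles et modules de Tate…*, Invent. Math. 65 (1982), §5. [Fontaine1982FormesDifferentielles]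
-/

noncomputable section

open Ideal Filter Topology Field WittVector MvPowerSeries

namespace Literature.NumberTheory.PAdicHodge

open Literature.NumberTheory.GaloisRepresentations
open Literature.NumberTheory.GaloisRepresentations.IsNonarchimedeanLocalField
open Literature.NumberTheory.GaloisRepresentations.LubinTate

namespace AinfTop

variable {F : Type} [Field F] [ValuativeRel F] [TopologicalSpace F] [IsNonarchimedeanLocalField F] [CharZero F]
  {p : ℕ} [Fact p.Prime] [Fact (¬ IsUnit (p : integerC F))]
  [IsAdicComplete (Ideal.span {(p : integerC F)}) (integerC F)]
  {hθ : Function.Surjective (fontaineTheta (integerC F) p)}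
  (W : WeierstrassCurve ℤ)

/-! ## §1 Points of `Ŵ(𝔫)` killed by `θ`, read in `Fil¹ B_dR⁺` -/

/-- A point of `Ŵ(𝔫)` killed by `θ` has its coordinate in `ker θ = ξ𝔸_inf`. [cite: FontaineAsterisque223III, Exp. II §1.2.2] -/
theorem mem_span_xi_of_thetaPt_eq_zero (z : W.Pt (nilTheta F p hθ)) (hz : thetaPt W hθ z = 0) :
    (of F p).symm (z.val : AinfTop F p) ∈ Ideal.span {(xi : Ainf (p := p) F)} := by
  have h1 : theta F p (z.val : AinfTop F p) = 0 := by
    rw [← coe_val_thetaPt, hz, WeierstrassCurve.Pt.val_zero]; rfl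
  rw [← ker_fontaineTheta_eq_span_xi, RingHom.mem_ker]
  have h' := congrArg (fun z : CBall F => (z : CompletedAlgClosure F)) h1
  simp only [ZeroMemClass.coe_zero] at h'
  exact Subtype.ext h'

/-- **A point `z ∈ Ŵ(𝔫)` with `θ(z) = 0`, read in `Fil¹ B_dR⁺ = (ξ_dR)`** (`ker θ = ξ𝔸_inf ↦ (ξ_dR)`).
[cite: FontaineAsterisque223III, Exp. II §1.5.2] -/
def kerFil (z : W.Pt (nilTheta F p hθ)) (hz : thetaPt W hθ z = 0) : (BdRPlusTop.filOne F p).toIdeal :=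
  ⟨BdRPlusTop.ofAinf F p ((of F p).symm (z.val : AinfTop F p)),
    BdRPlusTop.ofAinf_mem_filOne (mem_span_xi_of_thetaPt_eq_zero W z hz)⟩

/-- Unfolding `kerFil`. [cite: FontaineAsterisque223III, Exp. II §1.5.2] -/
@[simp] theorem coe_kerFil (z : W.Pt (nilTheta F p hθ)) (hz : thetaPt W hθ z = 0) :
    (kerFil W z hz : BdRPlusTop F p) = BdRPlusTop.ofAinf F p ((of F p).symm (z.val : AinfTop F p)) := rfl

/-- `kerFil` does not depend on the proof and respects equality of points. [cite: FontaineAsterisque223III, Exp. II §1.5.2] -/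
theorem kerFil_congr {z z' : W.Pt (nilTheta F p hθ)} (h : z = z') (hz : thetaPt W hθ z = 0) (hz' : thetaPt W hθ z' = 0) :
    kerFil W z hz = kerFil W z' hz' := by subst h; rfl

/-- `θ[τ] = 0` for `τ ∈ T_pŴ(𝒪_{ℂ_F})`, as points of `Ŵ(𝔪_{ℂ_F})`. [cite: FontaineAsterisque223III, Exp. II §1.2.2] -/
theorem thetaPt_torsionLiftHom (τ : TatePt F p W) : thetaPt W hθ (torsionLiftHom W hθ τ) = 0 :=
  WeierstrassCurve.Pt.ext (Subtype.ext (by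
    rw [coe_val_thetaPt, theta_torsionLiftHom, WeierstrassCurve.Pt.val_zero]; rfl))

/-- For `τ ∈ T_pŴ`, `kerFil [τ]` is the tree's `torsionLiftFil`. [cite: FontaineAsterisque223III, Exp. II §1.5.2] -/
theorem kerFil_torsionLiftHom (τ : TatePt F p W) :
    kerFil W (torsionLiftHom W hθ τ) (thetaPt_torsionLiftHom W τ) =
      torsionLiftFil W hθ (seq W τ) (seq_zero W τ) (mulPC_seq W τ) := rfl

/-- `θ(σ z) = 0` when `θ(z) = 0`. [cite: FontaineAsterisque223III, Exp. II §1.2] -/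
theorem thetaPt_galPtN_eq_zero (σ : absoluteGaloisGroup F) {z : W.Pt (nilTheta F p hθ)} (hz : thetaPt W hθ z = 0) :
    thetaPt W hθ (galPtN W hθ σ z) = 0 := by
  rw [thetaPt_galPtN, hz]
  exact (galPt W σ).map_zero

/-- **`Γ_F`-equivariance**: `σ(ι z) = ι(σ z)` in `Fil¹B_dR⁺`. [cite: FontaineAsterisque223III, Exp. II §1.5] -/
theorem gal_coe_kerFil (σ : absoluteGaloisGroup F) (z : W.Pt (nilTheta F p hθ)) (hz : thetaPt W hθ z = 0) :
    BdRPlusTop.gal F p σ (kerFil W z hz : BdRPlusTop F p) =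
      (kerFil W (galPtN W hθ σ z) (thetaPt_galPtN_eq_zero W σ hz) : BdRPlusTop F p) := by
  rw [coe_kerFil, coe_kerFil, BdRPlusTop.gal_ofAinf, coe_val_galPtN]
  rfl

/-- `θ(z + z') = 0` when `θ z = θ z' = 0`. [cite: CasselsFrohlichANT1967, Ch. VI §3.2] -/
theorem thetaPt_add_eq_zero {z z' : W.Pt (nilTheta F p hθ)} (hz : thetaPt W hθ z = 0) (hz' : thetaPt W hθ z' = 0) :
    thetaPt W hθ (z + z') = 0 := by
  rw [map_add, hz, hz', add_zero]

/-- **Addition read in `Fil¹`**: `ι(z + z') = F_W(ι z, ι z')`, the integral chord–tangent law evaluated `ξ`-adically in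
`B_dR⁺` (`𝔸_inf → B_dR⁺` commutes with evaluation at points of `ker θ`). [cite: FontaineAsterisque223III, Exp. II §1.5.2] -/
theorem coe_kerFil_add (z z' : W.Pt (nilTheta F p hθ)) (hz : thetaPt W hθ z = 0) (hz' : thetaPt W hθ z' = 0)
    (h : thetaPt W hθ (z + z') = 0) :
    (kerFil W (z + z') h : BdRPlusTop F p) =
      (evalPt (BdRPlusTop.filOne F p) W.formalGroupLaw W.constantCoeff_formalGroupLaw ![kerFil W z hz, kerFil W z' hz'] :
        BdRPlusTop F p) := by
  rw [coe_kerFil, val_add_N, addW]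
  exact AinfXiTop.ofAinf_evalPt W.formalGroupLaw W.constantCoeff_formalGroupLaw _
    (fun i => by
      fin_cases i
      · exact mem_span_xi_of_thetaPt_eq_zero W z hz
      · exact mem_span_xi_of_thetaPt_eq_zero W z' hz')
    _ (fun i => by fin_cases i <;> rfl)

/-! ## §2 `log_W` on `Ŵ(ker θ)` -/

/-- **`log_W(F_W(x, y)) = log_W(x) + log_W(y)` on `Fil¹B_dR⁺`** (AEC IV.5.2, evaluated `ξ`-adically).
[cite: SilvermanAEC2009, IV.5.2] [cite: FontaineAsterisque223III, Exp. II §1.5.4] -/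
theorem log_evalPt_formalGroupLaw (x y : (BdRPlusTop.filOne F p).toIdeal) :
    (evalPt₁ (BdRPlusTop.filOne F p) (logSeries W) (constantCoeff_logSeries W)
        (evalPt (BdRPlusTop.filOne F p) W.formalGroupLaw W.constantCoeff_formalGroupLaw ![x, y]) : BdRPlusTop F p) =
      evalPt₁ (BdRPlusTop.filOne F p) (logSeries W) (constantCoeff_logSeries W) x +
        evalPt₁ (BdRPlusTop.filOne F p) (logSeries W) (constantCoeff_logSeries W) y := by
  set V := W.map (Int.castRingHom RatCoeff) with hV
  have hFq : (MvPowerSeries.map (Int.castRingHom RatCoeff) W.formalGroupLaw).constantCoeff = 0 :=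
    BdRPlusTop.constantCoeff_map_int_eq_zero W.constantCoeff_formalGroupLaw
  -- the point `F(x, y)` of `Fil¹` is `F_ℚ(x, y)`
  have hpt : evalPt (BdRPlusTop.filOne F p) W.formalGroupLaw W.constantCoeff_formalGroupLaw ![x, y] =
      evalPt (BdRPlusTop.filOne F p) V.formalGroupLaw V.constantCoeff_formalGroupLaw ![x, y] := by
    apply Subtype.ext
    rw [BdRPlusTop.evalPt_map_int _ _ hFq]
    exact congrArg Subtype.val (evalPt_congr (BdRPlusTop.filOne F p) (map_formalGroupLaw_ratCoeff W) hFq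
      V.constantCoeff_formalGroupLaw ![x, y])
  have hlog0 : PowerSeries.constantCoeff V.formalLog = 0 := V.constantCoeff_formalLog
  have hsub0 : (V.formalLog.subst V.formalGroupLaw).constantCoeff = 0 :=
    constantCoeff_subst_zero (σ := Unit) (fun _ => V.constantCoeff_formalGroupLaw) hlog0
  have hX0 : ∀ i : Fin 2, (V.formalLog.subst (MvPowerSeries.X i : MvPowerSeries (Fin 2) RatCoeff)).constantCoeff = 0 :=
    fun i => constantCoeff_subst_zero (σ := Unit) (fun _ => MvPowerSeries.constantCoeff_X i) hlog0
  have hsum0 : (V.formalLog.subst (MvPowerSeries.X 0 : MvPowerSeries (Fin 2) RatCoeff) +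
      V.formalLog.subst (MvPowerSeries.X 1 : MvPowerSeries (Fin 2) RatCoeff)).constantCoeff = 0 := by
    rw [map_add, hX0 0, hX0 1, add_zero]
  rw [hpt]
  have hl : ∀ (z : (BdRPlusTop.filOne F p).toIdeal),
      (evalPt₁ (BdRPlusTop.filOne F p) (logSeries W) (constantCoeff_logSeries W) z : BdRPlusTop F p) =
        evalPt₁ (BdRPlusTop.filOne F p) V.formalLog hlog0 z := fun z =>
    congrArg Subtype.val (evalPt_congr (BdRPlusTop.filOne F p) (ι := Unit) (logSeries_eq_formalLog W)
      (constantCoeff_logSeries W) hlog0 fun _ => z)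
  rw [hl, hl, hl, ← evalPt₁_subst (BdRPlusTop.filOne F p) V.formalGroupLaw V.constantCoeff_formalGroupLaw V.formalLog hlog0 hsub0,
    evalPt_congr (BdRPlusTop.filOne F p) V.formalLog_subst_formalGroupLaw hsub0 hsum0 ![x, y], coe_evalPt, map_add,
    ← coe_evalPt (BdRPlusTop.filOne F p) _ (hX0 0), ← coe_evalPt (BdRPlusTop.filOne F p) _ (hX0 1),
    evalPt₁_subst (BdRPlusTop.filOne F p) (MvPowerSeries.X 0 : MvPowerSeries (Fin 2) RatCoeff) (MvPowerSeries.constantCoeff_X 0)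
      V.formalLog hlog0 (hX0 0),
    evalPt₁_subst (BdRPlusTop.filOne F p) (MvPowerSeries.X 1 : MvPowerSeries (Fin 2) RatCoeff) (MvPowerSeries.constantCoeff_X 1)
      V.formalLog hlog0 (hX0 1), evalPt_X, evalPt_X]
  rfl

/-- **`log_W(ι z) ∈ B_dR⁺(F)`** for a point `z ∈ Ŵ(𝔫)` with `θ(z) = 0`: the formal logarithm evaluated `ξ`-adically at
`ι z ∈ Fil¹`. [cite: Fontaine1982FormesDifferentielles, §5] [cite: SilvermanAEC2009, IV.5.5] -/
def logKer (z : W.Pt (nilTheta F p hθ)) (hz : thetaPt W hθ z = 0) : BdRPlusTop F p :=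
  (evalPt₁ (BdRPlusTop.filOne F p) (logSeries W) (constantCoeff_logSeries W) (kerFil W z hz) : BdRPlusTop F p)

/-- `logKer` respects equality of points (and ignores the proof). [cite: Fontaine1982FormesDifferentielles, §5] -/
theorem logKer_congr {z z' : W.Pt (nilTheta F p hθ)} (h : z = z') (hz : thetaPt W hθ z = 0) (hz' : thetaPt W hθ z' = 0) :
    logKer W z hz = logKer W z' hz' := by subst h; rfl

/-- `log_W(ι z) ∈ Fil¹ B_dR⁺`. [cite: Fontaine1982FormesDifferentielles, §5] -/
theorem logKer_mem_filOne (z : W.Pt (nilTheta F p hθ)) (hz : thetaPt W hθ z = 0) :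
    logKer W z hz ∈ (BdRPlusTop.filOne F p).toIdeal :=
  (evalPt₁ (BdRPlusTop.filOne F p) (logSeries W) (constantCoeff_logSeries W) (kerFil W z hz)).2

/-- **`logKer [τ] = ∫_τ ω`** for `τ ∈ T_pŴ(𝒪_{ℂ_F})`: on torsion sequences `logKer` IS the ω-period.
[cite: Fontaine1982FormesDifferentielles, §5] -/
theorem logKer_torsionLiftHom (τ : TatePt F p W) :
    logKer W (torsionLiftHom W hθ τ) (thetaPt_torsionLiftHom W τ) = omegaPeriodHom W hθ τ := rfl

/-- `logKer` of Fontaine's element of a torsion SEQUENCE is the ω-period of the sequence. [cite: Fontaine1982FormesDifferentielles, §5] -/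
theorem logKer_divisionLiftPt_of_zero {t : ℕ → (maxNilIdealC F).toIdeal} (ht0 : (t 0 : CBall F) = 0)
    (htp : ∀ n, mulPC F p W (t (n + 1)) = t n) (h : thetaPt W hθ (divisionLiftPt W hθ t htp) = 0) :
    logKer W (divisionLiftPt W hθ t htp) h = omegaPeriod W hθ t ht0 htp := rfl

/-- **`Γ_F`-equivariance: `σ(log_W(ι z)) = log_W(ι(σ z))`.** [cite: FontaineAsterisque223III, Exp. II §1.5.4] -/
theorem gal_logKer (σ : absoluteGaloisGroup F) (z : W.Pt (nilTheta F p hθ)) (hz : thetaPt W hθ z = 0) :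
    BdRPlusTop.gal F p σ (logKer W z hz) = logKer W (galPtN W hθ σ z) (thetaPt_galPtN_eq_zero W σ hz) := by
  rw [logKer, logKer, BdRPlusTop.gal_evalPt₁]
  congr 2
  exact Subtype.ext (gal_coe_kerFil W σ z hz)

/-- **Additivity: `log_W(ι(z + z')) = log_W(ι z) + log_W(ι z')`** on `Ŵ(ker θ)`. [cite: SilvermanAEC2009, IV.5.2]
[cite: Fontaine1982FormesDifferentielles, §5] -/
theorem logKer_add (z z' : W.Pt (nilTheta F p hθ)) (hz : thetaPt W hθ z = 0) (hz' : thetaPt W hθ z' = 0)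
    (h : thetaPt W hθ (z + z') = 0) : logKer W (z + z') h = logKer W z hz + logKer W z' hz' := by
  have hk : kerFil W (z + z') h =
      evalPt (BdRPlusTop.filOne F p) W.formalGroupLaw W.constantCoeff_formalGroupLaw ![kerFil W z hz, kerFil W z' hz'] :=
    Subtype.ext (coe_kerFil_add W z z' hz hz' h)
  rw [logKer, hk, log_evalPt_formalGroupLaw]
  rfl

/-- **The subgroup `Ŵ(ker θ) = ker(θ : Ŵ(𝔫) → Ŵ(𝔪_{ℂ_F}))`.** [cite: FontaineAsterisque223III, Exp. II §1.2.2] -/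
def thetaKer (hθ : Function.Surjective (fontaineTheta (integerC F) p)) : AddSubgroup (W.Pt (nilTheta F p hθ)) :=
  (thetaPt W hθ).ker

/-- Membership in `thetaKer`. [cite: FontaineAsterisque223III, Exp. II §1.2.2] -/
theorem mem_thetaKer_iff {z : W.Pt (nilTheta F p hθ)} : z ∈ thetaKer W hθ ↔ thetaPt W hθ z = 0 := (thetaPt W hθ).mem_ker

/-- **`log_W ∘ ι : Ŵ(ker θ) →+ B_dR⁺(F)` as a group homomorphism.** [cite: Fontaine1982FormesDifferentielles, §5] -/
def logKerHom (hθ : Function.Surjective (fontaineTheta (integerC F) p)) : thetaKer W hθ →+ BdRPlusTop F p :=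
  AddMonoidHom.mk' (fun z => logKer W z.1 ((mem_thetaKer_iff W).1 z.2)) fun z z' =>
    logKer_add W z.1 z'.1 ((mem_thetaKer_iff W).1 z.2) ((mem_thetaKer_iff W).1 z'.2) _

/-- Unfolding `logKerHom`. [cite: Fontaine1982FormesDifferentielles, §5] -/
theorem logKerHom_apply (z : thetaKer W hθ) : logKerHom W hθ z = logKer W z.1 ((mem_thetaKer_iff W).1 z.2) := rfl

/-- `log_W(ι 0) = 0`. [cite: SilvermanAEC2009, IV.5.5] -/
theorem logKer_zero (h : thetaPt W hθ (0 : W.Pt (nilTheta F p hθ)) = 0) : logKer W 0 h = 0 := by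
  have h2 := logKer_add W 0 0 h h (by rw [add_zero]; exact h)
  have e : logKer W (0 + 0) (by rw [add_zero]; exact h) = logKer W 0 h := logKer_congr W (add_zero 0) _ _
  rw [e] at h2
  exact left_eq_add.mp h2

/-- `log_W(ι(z − z')) = log_W(ι z) − log_W(ι z')`. [cite: SilvermanAEC2009, IV.5.2] -/
theorem logKer_sub (z z' : W.Pt (nilTheta F p hθ)) (hz : thetaPt W hθ z = 0) (hz' : thetaPt W hθ z' = 0)
    (h : thetaPt W hθ (z - z') = 0) : logKer W (z - z') h = logKer W z hz - logKer W z' hz' := by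
  have e := map_sub (logKerHom W hθ) ⟨z, (mem_thetaKer_iff W).2 hz⟩ ⟨z', (mem_thetaKer_iff W).2 hz'⟩
  rw [logKerHom_apply, logKerHom_apply, logKerHom_apply] at e
  exact (logKer_congr W rfl _ _).trans e

/-! ## §3 The Kummer integral of a division sequence with a `Γ_F`-fixed lift of its base point -/

section Kummer

variable {u : ℕ → (maxNilIdealC F).toIdeal} (hup : ∀ n, mulPC F p W (u (n + 1)) = u n)
  {Q : W.Pt (nilTheta F p hθ)}

/-- **Rationality of the base point from a fixed lift**: if `Q ∈ Ŵ(𝔫)` is `Γ_F`-fixed with `θ(Q) = u₀`, then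
`σ u₀ = u₀` for all `σ ∈ Γ_F`. [cite: FontaineAsterisque223III, Exp. II §1.2] -/
theorem galCBall_base_eq_of_fixedLift (hQ : thetaPt W hθ Q = ⟨u 0⟩) (hQσ : ∀ σ : absoluteGaloisGroup F, galPtN W hθ σ Q = Q)
    (σ : absoluteGaloisGroup F) : galCBall σ (u 0 : CBall F) = u 0 := by
  have h := thetaPt_galPtN W σ Q
  rw [hQσ σ, hQ] at h
  have h' := congrArg (fun P : W.Pt (maxNilIdealC F) => (P.val : CBall F)) h
  simp only [smul_def, coe_val_galPt] at h'
  exact h'.symm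

/-- **The Kummer integral `z_u := [ũ] − Q ∈ Ŵ(𝔫)`** of the division sequence `u` relative to the lift `Q` of its base point.
[cite: FontaineAsterisque223III, Exp. II §1.2.2] [cite: BlochKato1990, Ex. 3.10.1] -/
def kummerIntegralPt (hup : ∀ n, mulPC F p W (u (n + 1)) = u n) (Q : W.Pt (nilTheta F p hθ)) : W.Pt (nilTheta F p hθ) :=
  divisionLiftPt W hθ u hup - Q

/-- Unfolding `kummerIntegralPt`. [cite: FontaineAsterisque223III, Exp. II §1.2.2] -/
theorem kummerIntegralPt_def (Q : W.Pt (nilTheta F p hθ)) : kummerIntegralPt W hup Q = divisionLiftPt W hθ u hup - Q := rfl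

/-- **`θ(z_u) = 0`**: `θ[ũ] = u₀ = θ(Q)`. [cite: FontaineAsterisque223III, Exp. II §1.2.2] -/
theorem thetaPt_kummerIntegralPt (hQ : thetaPt W hθ Q = ⟨u 0⟩) : thetaPt W hθ (kummerIntegralPt W hup Q) = 0 := by
  rw [kummerIntegralPt, map_sub, thetaPt_divisionLiftPt, hQ, sub_self]

/-- **`σ(z_u) = z_u + [κ_u(σ)]`** in `Ŵ(𝔫)` (`Q` is fixed and `(σ − 1)[ũ] = [κ_u σ]`). [cite: FontaineAsterisque223III, Exp. II §1.2.2]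
[cite: BlochKato1990, Ex. 3.10.1] -/
theorem galPtN_kummerIntegralPt (hQσ : ∀ σ : absoluteGaloisGroup F, galPtN W hθ σ Q = Q) (σ : absoluteGaloisGroup F) :
    galPtN W hθ σ (kummerIntegralPt W hup Q) =
      kummerIntegralPt W hup Q + divisionLiftPt W hθ (kummerSeq W σ u) (mulPC_kummerSeq W σ hup) := by
  rw [kummerIntegralPt, map_sub, hQσ, divisionLiftPt_kummerSeq W σ hup]
  abel

/-- `θ[κ_u(σ)] = 0` as a point (the Kummer torsion sequence starts at `0` when `u₀` is rational).
[cite: BlochKato1990, Ex. 3.10.1] -/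
theorem thetaPt_divisionLiftPt_kummerSeq (hQ : thetaPt W hθ Q = ⟨u 0⟩)
    (hQσ : ∀ σ : absoluteGaloisGroup F, galPtN W hθ σ Q = Q) (σ : absoluteGaloisGroup F) :
    thetaPt W hθ (divisionLiftPt W hθ (kummerSeq W σ u) (mulPC_kummerSeq W σ hup)) = 0 := by
  rw [thetaPt_divisionLiftPt]
  exact WeierstrassCurve.Pt.ext (Subtype.ext (coe_kummerSeq_zero W σ (galCBall_base_eq_of_fixedLift W hQ hQσ σ)))

/-- **The ω-integrating element `b_ω := log_W(ι z_u) ∈ B_dR⁺(F)`** of the Kummer cocycle of `u`.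
[cite: BlochKato1990, Ex. 3.10.1] [cite: Kato1993LNM1553, Ch. II Lemma 1.4.3] -/
def bOmega (hup : ∀ n, mulPC F p W (u (n + 1)) = u n) (hQ : thetaPt W hθ Q = ⟨u 0⟩) : BdRPlusTop F p :=
  logKer W (kummerIntegralPt W hup Q) (thetaPt_kummerIntegralPt W hup hQ)

/-- `b_ω ∈ Fil¹ B_dR⁺`. [cite: Fontaine1982FormesDifferentielles, §5] -/
theorem bOmega_mem_filOne (hQ : thetaPt W hθ Q = ⟨u 0⟩) : bOmega W hup hQ ∈ (BdRPlusTop.filOne F p).toIdeal :=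
  logKer_mem_filOne W _ _

/-- **THE COBOUNDARY IDENTITY `σ(b_ω) − b_ω = ∫_{κ_u(σ)} ω`** (sequence form): the Galois coboundary of `b_ω` is the
ω-period of the Kummer torsion sequence `κ_u(σ) = σu ⊖ u`. [cite: BlochKato1990, Ex. 3.10.1] [cite: Kato1993LNM1553, Ch. II Lemma 1.4.3]
[cite: FontaineAsterisque223III, Exp. II §1.5.4] -/
theorem gal_bOmega_sub_bOmega (hQ : thetaPt W hθ Q = ⟨u 0⟩) (hQσ : ∀ σ : absoluteGaloisGroup F, galPtN W hθ σ Q = Q)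
    (σ : absoluteGaloisGroup F) :
    BdRPlusTop.gal F p σ (bOmega W hup hQ) - bOmega W hup hQ =
      omegaPeriod W hθ (kummerSeq W σ u) (coe_kummerSeq_zero W σ (galCBall_base_eq_of_fixedLift W hQ hQσ σ))
        (mulPC_kummerSeq W σ hup) := by
  rw [bOmega, gal_logKer, logKer_congr W (galPtN_kummerIntegralPt W hup hQσ σ) _
      (thetaPt_add_eq_zero W (thetaPt_kummerIntegralPt W hup hQ) (thetaPt_divisionLiftPt_kummerSeq W hup hQ hQσ σ)),
    logKer_add W _ _ (thetaPt_kummerIntegralPt W hup hQ) (thetaPt_divisionLiftPt_kummerSeq W hup hQ hQσ σ), add_sub_cancel_left]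
  rfl

/-- **THE COBOUNDARY IDENTITY, Tate-module form: `σ(b_ω) − b_ω = ∫_{κ_u(σ)} ω = omegaPeriodHom (kummerCocycle u σ)`.**
[cite: BlochKato1990, Ex. 3.10.1] [cite: Kato1993LNM1553, Ch. II Lemma 1.4.3] -/
theorem gal_bOmega_sub_bOmega_eq_omegaPeriodHom (hQ : thetaPt W hθ Q = ⟨u 0⟩)
    (hQσ : ∀ σ : absoluteGaloisGroup F, galPtN W hθ σ Q = Q) (σ : absoluteGaloisGroup F) :
    BdRPlusTop.gal F p σ (bOmega W hup hQ) - bOmega W hup hQ =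
      omegaPeriodHom W hθ (kummerCocycle W u hup (galCBall_base_eq_of_fixedLift W hQ hQσ) σ) := by
  rw [gal_bOmega_sub_bOmega W hup hQ hQσ σ, omegaPeriodHom_apply]
  rfl

/-- **Brick K1, floor 3 (ω): the Kummer cocycle of a division sequence with a `Γ_F`-fixed lift of its base point has an
ω-integrating element in `Fil¹B_dR⁺(F)`.** [cite: BlochKato1990, Ex. 3.10.1, (3.11.1)] [cite: Kato1993LNM1553, Ch. II Lemma 1.4.3] -/
theorem exists_gal_sub_eq_omegaPeriodHom_kummerCocycle (hQ : thetaPt W hθ Q = ⟨u 0⟩)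
    (hQσ : ∀ σ : absoluteGaloisGroup F, galPtN W hθ σ Q = Q) :
    ∃ b : BdRPlusTop F p, b ∈ (BdRPlusTop.filOne F p).toIdeal ∧ ∀ σ : absoluteGaloisGroup F,
      BdRPlusTop.gal F p σ b - b = omegaPeriodHom W hθ (kummerCocycle W u hup (galCBall_base_eq_of_fixedLift W hQ hQσ) σ) :=
  ⟨bOmega W hup hQ, bOmega_mem_filOne W hup hQ, gal_bOmega_sub_bOmega_eq_omegaPeriodHom W hup hQ hQσ⟩

end Kummer

/-! ## §4 Fixed lifts of `ℚ_p`-rational base points: `pℤ_p ⊂ 𝔫` -/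

/-- `p·c ∈ 𝔫` for `c ∈ ℤ_p ⊆ 𝔸_inf(F)` (`(p, ξ) ⊆ 𝔫`). [cite: FontaineAsterisque223III, Exp. II §1.2.2] -/
theorem of_zpToAinf_mul_mem_nilTheta (c : ℤ_[p]) :
    of F p (zpToAinf ((p : ℤ_[p]) * c)) ∈ (nilTheta F p hθ).toIdeal := by
  rw [map_mul, map_mul, map_natCast, map_natCast]
  refine Ideal.mul_mem_right _ _ (ideal_le_nilTheta ?_)
  rw [ideal_eq]
  exact Ideal.subset_span (by simp)

/-- **The constant point `P_c ∈ Ŵ(𝔫)` with coordinate `p·c`, `c ∈ ℤ_p`** — a `Γ_F`-fixed lift of the `ℚ_p`-rational point of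
`Ŵ(pℤ_p)` with parameter `p·c`. [cite: FontaineAsterisque223III, Exp. II §1.2.2] -/
def zpPt (hθ : Function.Surjective (fontaineTheta (integerC F) p)) (c : ℤ_[p]) : W.Pt (nilTheta F p hθ) :=
  ⟨⟨of F p (zpToAinf ((p : ℤ_[p]) * c)), of_zpToAinf_mul_mem_nilTheta c⟩⟩

/-- Unfolding `zpPt`. [cite: FontaineAsterisque223III, Exp. II §1.2.2] -/
@[simp] theorem coe_val_zpPt (c : ℤ_[p]) : ((zpPt W hθ c).val : AinfTop F p) = of F p (zpToAinf ((p : ℤ_[p]) * c)) := rfl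

/-- **`Γ_F` fixes `P_c`** (`Γ_F` fixes `ℤ_p ⊆ 𝔸_inf`). [cite: FontaineAsterisque223III, Exp. II §1.2] -/
theorem galPtN_zpPt (σ : absoluteGaloisGroup F) (c : ℤ_[p]) : galPtN W hθ σ (zpPt W hθ c) = zpPt W hθ c :=
  WeierstrassCurve.Pt.ext (Subtype.ext (by rw [coe_val_galPtN, coe_val_zpPt, gal_of, galAinf_zpToAinf]))

/-- **Brick K1, floor 3 (ω), for `ℚ_p`-rational base points**: a `[p]`-division sequence `u` in `Ŵ(𝔪_{ℂ_F})` whose base point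
`u₀` is the point with parameter `p·c`, `c ∈ ℤ_p`, has an ω-integrating element `b ∈ Fil¹B_dR⁺(F)`:
`σ b − b = ∫_{κ_u(σ)} ω` for all `σ ∈ Γ_F`. [cite: BlochKato1990, Ex. 3.10.1, (3.11.1)] [cite: Kato1993LNM1553, Ch. II Lemma 1.4.3] -/
theorem exists_gal_sub_eq_omegaPeriod_of_zp {u : ℕ → (maxNilIdealC F).toIdeal} (hup : ∀ n, mulPC F p W (u (n + 1)) = u n)
    (c : ℤ_[p]) (hu0 : (u 0 : CBall F) = theta F p (of F p (zpToAinf ((p : ℤ_[p]) * c)))) :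
    ∃ hu₀ : ∀ σ : absoluteGaloisGroup F, galCBall σ (u 0 : CBall F) = u 0,
      ∃ b : BdRPlusTop F p, b ∈ (BdRPlusTop.filOne F p).toIdeal ∧ ∀ σ : absoluteGaloisGroup F,
        BdRPlusTop.gal F p σ b - b = omegaPeriodHom W hθ (kummerCocycle W u hup hu₀ σ) := by
  have hQ : thetaPt W hθ (zpPt W hθ c) = ⟨u 0⟩ :=
    WeierstrassCurve.Pt.ext (Subtype.ext (by rw [coe_val_thetaPt, coe_val_zpPt, hu0]))
  exact ⟨galCBall_base_eq_of_fixedLift W hQ fun σ => galPtN_zpPt W σ c,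
    exists_gal_sub_eq_omegaPeriodHom_kummerCocycle W hup hQ fun σ => galPtN_zpPt W σ c⟩

end AinfTop

end Literature.NumberTheory.PAdicHodge

end
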